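import Summits.CriticalPhenomena.PercolationContinuityZ3.Theorems.SoloInformedSheetGluing
import Summits.CriticalPhenomena.PercolationContinuityZ3.Theorems.SoloInformedCubeFace
import HarnessLib

/-!
# Beam gluing: the RSW extension step iterated to square beams of every length, and the near-cube
brick as a translated box (solo seat `solo-CriticalPhenomena-informed`, paper §7b.3 (d6), §8.1)

Bookkeeping around the sheet-gluing inequality `real_sheet_gluing_sq` (file `SoloInformedSheetGluing`)
needed to run the paper's last reduction end to end (file `SoloInformedSquareBeamAssembly`):

* `vertCrossing_mono`, `real_vertCrossing_compl_anti` — a vertical crossing of a box is one of every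
  wider / longer box of the same height; blocking probabilities decrease in the lateral extents;
* `real_curtainCrossing_eq` — translating by `a` along `k₁`, the curtain crossing of the overlap
  `B[a, a+n]` is the vertical crossing of a box with the roles of `k₀` (vertical) and `k₁`
  (longitudinal) exchanged; so the connector of the extension step for beams of square cross-section
  `n × n` overlapping in a cube is a CUBE crossing (`real_beam_glue`:
  `P(beam L)² · P(cube, vertical k₁) ≤ P(beam 2L − n)`, all events "blocked");
* `real_beam_iter` — iterating, a blocked `(n+u)`-beam and blocked cubes give blocked beams of
  every length `n + 2^i u` with constants `c_i(c) > 0`;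
* `real_slabCrossing_four_eq` — the near-cube brick `[0,6u]^d ∩ {u ≤ x_k ≤ 5u}` of the cube face
  (`SoloInformedCubeFace`, `r = 4`) crossed in direction `k` has the probability of the vertical
  crossing of the box of height `4u`, width and extent `6u` (translation by `u e_k`).

All statements hold in every dimension and at every `p`; Harris–FKG enters only through
`real_sheet_gluing_sq`.  References: G. Grimmett, *Percolation*, 2nd ed., Springer 1999, §11.7 (RSW
extension) and Thm. (2.4) (Harris–FKG). [folklore]
-/

noncomputable section

namespace Summit.CriticalPhenomena.PercolationContinuityZ3.Theorems

open MeasureTheory ProbabilityTheory Filter Topology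
open Literature.Probability.Percolation Literature.Probability.LatticeModels
open Literature.Probability.Percolation.CerfDembinVanishing
open scoped ENNReal

namespace SurfaceTension

variable {d : ℕ}

/-! ## Monotonicity of box crossings in the lateral extents -/

/-- `linked` is monotone in all three arguments. -/
theorem linked_mono {S S' A A' B B' : Set (Site d)} (hS : S ⊆ S') (hA : A ⊆ A') (hB : B ⊆ B') :
    linked S A B ⊆ linked S' A' B' := by
  intro ω hω
  rw [mem_linked_iff] at hω ⊢
  obtain ⟨a, ha, b, hb, hab⟩ := hω
  exact ⟨a, hA ha, b, hB hb, inConn_mono hS a b hab⟩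

/-- Boxes grow with the width `ℓ` and the right end `b`. -/
theorem xBox_mono {ℓ ℓ' : ℕ} (hℓ : ℓ ≤ ℓ') (t : ℕ) (k₀ k₁ : Fin d) (a : ℤ) {b b' : ℤ}
    (hb : b ≤ b') : xBox ℓ t k₀ k₁ a b ⊆ xBox ℓ' t k₀ k₁ a b' := by
  intro x hx
  simp only [xBox, Set.mem_setOf_eq] at hx ⊢
  refine ⟨⟨hx.1.1, hx.1.2.trans hb⟩, hx.2.1, fun j hj₀ hj₁ => ⟨(hx.2.2 j hj₀ hj₁).1, ?_⟩⟩
  exact (hx.2.2 j hj₀ hj₁).2.trans (by exact_mod_cast hℓ)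

/-- A vertical crossing of a box is a vertical crossing of every wider / longer box of the same
height containing it (same bottom level, same left end). -/
theorem vertCrossing_mono {ℓ ℓ' : ℕ} (hℓ : ℓ ≤ ℓ') (t : ℕ) (k₀ k₁ : Fin d) (a : ℤ) {b b' : ℤ}
    (hb : b ≤ b') : vertCrossing ℓ t k₀ k₁ a b ⊆ vertCrossing ℓ' t k₀ k₁ a b' := by
  have hB := xBox_mono hℓ t k₀ k₁ a hb
  refine linked_mono hB ?_ ?_
  · intro x hx
    simp only [xBot, Set.mem_setOf_eq] at hx ⊢
    exact ⟨hB hx.1, hx.2⟩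
  · intro x hx
    simp only [xTop, Set.mem_setOf_eq] at hx ⊢
    exact ⟨hB hx.1, hx.2⟩

/-- Blocking probabilities decrease in the lateral extents. -/
theorem real_vertCrossing_compl_anti (p : unitInterval) {ℓ ℓ' : ℕ} (hℓ : ℓ ≤ ℓ') (t : ℕ)
    (k₀ k₁ : Fin d) (a : ℤ) {b b' : ℤ} (hb : b ≤ b') :
    (bondPercolation (zdGraph d) p).real (vertCrossing ℓ' t k₀ k₁ a b')ᶜ ≤
      (bondPercolation (zdGraph d) p).real (vertCrossing ℓ t k₀ k₁ a b)ᶜ :=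
  measureReal_mono (Set.compl_subset_compl.2 (vertCrossing_mono hℓ t k₀ k₁ a hb))

/-! ## The curtain of the overlap is a box crossing with the roles of `k₀, k₁` exchanged -/

/-- Translating by `a` along `k₁`: the curtain-crossing probability of `B[a, a+n]` (width `ℓ`,
height `t`, vertical `k₀`, longitudinal `k₁`) equals the vertical-crossing probability of the box
with vertical direction `k₁`, height `n`, longitudinal direction `k₀` and extent `t`, width `ℓ`. -/
theorem real_curtainCrossing_eq (p : unitInterval) (ℓ t n : ℕ) {k₀ k₁ : Fin d} (hk : k₀ ≠ k₁)
    (a : ℤ) :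
    (bondPercolation (zdGraph d) p).real (curtainCrossing ℓ t k₀ k₁ a (a + n)) =
      (bondPercolation (zdGraph d) p).real (vertCrossing ℓ n k₁ k₀ 0 t) := by
  set w : Site d := Pi.single k₁ a with hw
  set φ : zdGraph d ≃g zdGraph d := zdShiftIso w with hφ
  have key₁ : ∀ x : Site d, (φ x) k₁ = x k₁ + a := fun x => by simp [hφ, hw]
  have key₀ : ∀ x : Site d, ∀ j, j ≠ k₁ → (φ x) j = x j := fun x j hj => by
    simp [hφ, hw, Pi.single_eq_of_ne hj]
  have hS : ∀ x : Site d, x ∈ xBox ℓ n k₁ k₀ 0 t ↔ φ x ∈ xBox ℓ t k₀ k₁ a (a + n) := by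
    intro x
    simp only [xBox, Set.mem_setOf_eq, key₁, key₀ x k₀ hk]
    constructor
    · rintro ⟨h0, h1, h2⟩
      refine ⟨⟨by linarith [h1.1], by linarith [h1.2]⟩, h0, fun j hj0 hj1 => ?_⟩
      rw [key₀ x j hj1]
      exact h2 j hj1 hj0
    · rintro ⟨h1, h0, h2⟩
      refine ⟨h0, ⟨by linarith [h1.1], by linarith [h1.2]⟩, fun j hj1 hj0 => ?_⟩
      have := h2 j hj0 hj1
      rwa [key₀ x j hj1] at this
  have hSim : (φ.toEquiv : Site d ≃ Site d) '' xBox ℓ n k₁ k₀ 0 t = xBox ℓ t k₀ k₁ a (a + n) :=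
    image_eq_of_forall_iff φ.toEquiv hS
  have hBim : (φ.toEquiv : Site d ≃ Site d) '' xBot ℓ n k₁ k₀ 0 t =
      xFace ℓ t k₀ k₁ a (a + n) a :=
    image_eq_of_forall_iff φ.toEquiv fun x => by
      simp only [xBot, xFace, Set.mem_setOf_eq, hS]
      exact and_congr_right fun _ => by
        rw [show ((φ.toEquiv : Site d ≃ Site d) x) k₁ = (φ x) k₁ from rfl, key₁ x]
        constructor <;> intro h <;> linarith
  have hTim : (φ.toEquiv : Site d ≃ Site d) '' xTop ℓ n k₁ k₀ 0 t =
      xFace ℓ t k₀ k₁ a (a + n) (a + n) :=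
    image_eq_of_forall_iff φ.toEquiv fun x => by
      simp only [xTop, xFace, Set.mem_setOf_eq, hS]
      exact and_congr_right fun _ => by
        rw [show ((φ.toEquiv : Site d ≃ Site d) x) k₁ = (φ x) k₁ from rfl, key₁ x]
        constructor <;> intro h <;> linarith
  have himg := real_linked_image φ p (xBox ℓ n k₁ k₀ 0 t) (xBot ℓ n k₁ k₀ 0 t)
    (xTop ℓ n k₁ k₀ 0 t)
  rw [curtainCrossing, vertCrossing, ← himg]
  change _ = (bondPercolation (zdGraph d) p).real
      (linked ((φ.toEquiv : Site d ≃ Site d) '' xBox ℓ n k₁ k₀ 0 t)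
        ((φ.toEquiv : Site d ≃ Site d) '' xBot ℓ n k₁ k₀ 0 t)
        ((φ.toEquiv : Site d ≃ Site d) '' xTop ℓ n k₁ k₀ 0 t))
  rw [hSim, hBim, hTim]

/-! ## Gluing square beams -/

/-- **One extension step for beams of square cross-section.** Two blocked beams `n × n × L`
(`L ≥ n`, vertical `k₀`, longitudinal `k₁`) overlapping in a cube of side `n`, glued by a blocked
cube with vertical direction `k₁`, give a blocked beam of longitudinal extent `2L − n`:
`P(beam L blocked)² · P(cube blocked, vertical k₁) ≤ P(beam 2L − n blocked)`. -/
theorem real_beam_glue (p : unitInterval) (n L : ℕ) {k₀ k₁ : Fin d} (hk : k₀ ≠ k₁)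
    (hnL : n ≤ L) :
    (bondPercolation (zdGraph d) p).real (vertCrossing n n k₀ k₁ 0 (L : ℕ))ᶜ ^ 2 *
        (bondPercolation (zdGraph d) p).real (vertCrossing n n k₁ k₀ 0 (n : ℕ))ᶜ ≤
      (bondPercolation (zdGraph d) p).real (vertCrossing n n k₀ k₁ 0 (2 * L - n : ℕ))ᶜ := by
  have hnL' : (n : ℤ) ≤ L := by exact_mod_cast hnL
  have hn0 : (0 : ℤ) ≤ n := by positivity
  have h := real_sheet_gluing_sq p n n hk (a := (L : ℤ) - n) (ℓ' := (L : ℤ)) (by linarith)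
    (by linarith)
  have hc : (bondPercolation (zdGraph d) p).real (curtainCrossing n n k₀ k₁ ((L : ℤ) - n) L)ᶜ =
      (bondPercolation (zdGraph d) p).real (vertCrossing n n k₁ k₀ 0 (n : ℕ))ᶜ := by
    have := real_curtainCrossing_eq p n n n hk ((L : ℤ) - n)
    rw [show (L : ℤ) - n + (n : ℕ) = (L : ℤ) by ring] at this
    rw [probReal_compl_eq_one_sub (measurableSet_curtainCrossing _ _ _ _ _ _),
      probReal_compl_eq_one_sub (measurableSet_vertCrossing _ _ _ _ _ _), this]
  have e : ((2 * L - n : ℕ) : ℤ) = (L : ℤ) - n + L := by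
    have h2 : n ≤ 2 * L := by omega
    rw [Nat.cast_sub h2]
    push_cast
    ring
  rw [e, ← hc]
  exact h

/-- **Iterated extension.** If the `(n+u)`-beam (vertical `k₀`, longitudinal `k₁`) and the cube
of side `n` with vertical direction `k₁` are blocked with probability `≥ c > 0`, then the
`(n + 2^i u)`-beam is blocked with probability `≥ c_i > 0`, `c_i` depending only on `c` and `i`. -/
theorem real_beam_iter (p : unitInterval) {k₀ k₁ : Fin d} (hk : k₀ ≠ k₁) {c : ℝ} (hc : 0 < c)
    (i : ℕ) :
    ∃ c' : ℝ, 0 < c' ∧ ∀ n u : ℕ,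
      c ≤ (bondPercolation (zdGraph d) p).real (vertCrossing n n k₀ k₁ 0 (n + u : ℕ))ᶜ →
      c ≤ (bondPercolation (zdGraph d) p).real (vertCrossing n n k₁ k₀ 0 (n : ℕ))ᶜ →
      c' ≤ (bondPercolation (zdGraph d) p).real
        (vertCrossing n n k₀ k₁ 0 (n + 2 ^ i * u : ℕ))ᶜ := by
  induction i with
  | zero => exact ⟨c, hc, fun n u h₁ _ => by simpa using h₁⟩
  | succ i ih =>
    obtain ⟨c', hc', h'⟩ := ih
    refine ⟨c' ^ 2 * c, by positivity, fun n u h₁ h₂ => ?_⟩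
    have hL := h' n u h₁ h₂
    have hg := real_beam_glue p n (n + 2 ^ i * u) hk (Nat.le_add_right _ _)
    have e : 2 * (n + 2 ^ i * u) - n = n + 2 ^ (i + 1) * u := by
      have : 2 ^ (i + 1) * u = 2 * (2 ^ i * u) := by ring
      omega
    rw [e] at hg
    calc c' ^ 2 * c
        ≤ (bondPercolation (zdGraph d) p).real
              (vertCrossing n n k₀ k₁ 0 (n + 2 ^ i * u : ℕ))ᶜ ^ 2 *
            (bondPercolation (zdGraph d) p).real (vertCrossing n n k₁ k₀ 0 (n : ℕ))ᶜ :=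
          mul_le_mul (pow_le_pow_left₀ hc'.le hL 2) h₂ hc.le (by positivity)
      _ ≤ _ := hg

/-! ## The near-cube brick of the cube face as a translated box -/

/-- The near-cube crossing event of the cube face with `r = 4` and corner `0` — the brick
`[0,6u]^d ∩ {u ≤ x_k ≤ 5u}` crossed in direction `k` — has the probability of the vertical crossing
of the box of height `4u`, width and longitudinal extent `6u` (translate by `u` along `k`). -/
theorem real_slabCrossing_four_eq (p : unitInterval) (u : ℕ) {k k' : Fin d} (hk : k ≠ k') :
    (bondPercolation (zdGraph d) p).real (slabCrossing u 4 k 0) =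
      (bondPercolation (zdGraph d) p).real
        (vertCrossing (6 * u) (4 * u) k k' 0 (6 * u : ℕ)) := by
  set w : Site d := Pi.single k (u : ℤ) with hw
  set φ : zdGraph d ≃g zdGraph d := zdShiftIso w with hφ
  have keyk : ∀ x : Site d, (φ x) k = x k + u := fun x => by simp [hφ, hw]
  have key' : ∀ x : Site d, ∀ j, j ≠ k → (φ x) j = x j := fun x j hj => by
    simp [hφ, hw, Pi.single_eq_of_ne hj]
  have hS : ∀ x : Site d,
      x ∈ xBox (6 * u) (4 * u) k k' 0 (6 * u : ℕ) ↔ φ x ∈ midSlab u 4 k 0 := by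
    intro x
    have hu0 : (0 : ℤ) ≤ (u : ℤ) := by positivity
    simp only [xBox, midSlab, Set.mem_setOf_eq, Pi.zero_apply, mul_zero, zero_add, keyk]
    push_cast
    constructor
    · rintro ⟨h1, h0, h2⟩
      refine ⟨fun j => ?_, by linarith [h0.1], by linarith [h0.2]⟩
      by_cases hj : j = k
      · subst hj
        rw [keyk]
        constructor <;> linarith [h0.1, h0.2]
      · rw [key' x j hj]
        by_cases hj' : j = k'
        · subst hj'
          constructor <;> linarith [h1.1, h1.2]
        · have := h2 j hj hj'
          constructor <;> linarith [this.1, this.2]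
    · rintro ⟨hall, hlo, hhi⟩
      refine ⟨?_, ⟨by linarith, by linarith⟩, fun j hj hj' => ?_⟩
      · have := hall k'
        rw [key' x k' (Ne.symm hk)] at this
        constructor <;> linarith [this.1, this.2]
      · have := hall j
        rw [key' x j hj] at this
        constructor <;> linarith [this.1, this.2]
  have hSim : (φ.toEquiv : Site d ≃ Site d) '' xBox (6 * u) (4 * u) k k' 0 (6 * u : ℕ) =
      midSlab u 4 k 0 := image_eq_of_forall_iff φ.toEquiv hS
  have hBim : (φ.toEquiv : Site d ≃ Site d) '' xBot (6 * u) (4 * u) k k' 0 (6 * u : ℕ) =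
      loFace u 4 k 0 :=
    image_eq_of_forall_iff φ.toEquiv fun x => by
      simp only [xBot, loFace, Set.mem_setOf_eq, hS, Pi.zero_apply, mul_zero, zero_add]
      exact and_congr_right fun _ => by
        rw [show ((φ.toEquiv : Site d ≃ Site d) x) k = (φ x) k from rfl, keyk x]
        constructor <;> intro h <;> linarith
  have hTim : (φ.toEquiv : Site d ≃ Site d) '' xTop (6 * u) (4 * u) k k' 0 (6 * u : ℕ) =
      hiFace u 4 k 0 :=
    image_eq_of_forall_iff φ.toEquiv fun x => by
      simp only [xTop, hiFace, Set.mem_setOf_eq, hS, Pi.zero_apply, mul_zero, zero_add]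
      exact and_congr_right fun _ => by
        rw [show ((φ.toEquiv : Site d ≃ Site d) x) k = (φ x) k from rfl, keyk x]
        push_cast
        constructor <;> intro h <;> linarith
  have himg := real_linked_image φ p (xBox (6 * u) (4 * u) k k' 0 (6 * u : ℕ))
    (xBot (6 * u) (4 * u) k k' 0 (6 * u : ℕ)) (xTop (6 * u) (4 * u) k k' 0 (6 * u : ℕ))
  rw [slabCrossing, vertCrossing, ← himg]
  change _ = (bondPercolation (zdGraph d) p).real
      (linked ((φ.toEquiv : Site d ≃ Site d) '' xBox (6 * u) (4 * u) k k' 0 (6 * u : ℕ))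
        ((φ.toEquiv : Site d ≃ Site d) '' xBot (6 * u) (4 * u) k k' 0 (6 * u : ℕ))
        ((φ.toEquiv : Site d ≃ Site d) '' xTop (6 * u) (4 * u) k k' 0 (6 * u : ℕ)))
  rw [hSim, hBim, hTim]

end SurfaceTension

end Summit.CriticalPhenomena.PercolationContinuityZ3.Theorems

end
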